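import Literature.MathematicalPhysics.QuantumFieldTheory.Balaban1983to89.B9Eq316TowerFlatIsOneStep
import Literature.MathematicalPhysics.QuantumFieldTheory.Balaban1983to89.B9Eq315QTowerFlat
import Literature.MathematicalPhysics.QuantumFieldTheory.Balaban1983to89.B9Eq319QprimeBlockLocal

/-!
# `Balaban1983to89.B9Eq319QprimeTowerBlockLocal` — T. Bałaban, *Propagators for lattice gauge theories in a background field*, Commun. Math. Phys. **99**
# (1985) 389–434 [Balaban1985BackgroundPropagators] (3.15) ∕ (3.19) p. 393, p. 403, Thm 3.11 p. 416, with [Balaban1984PropagatorsI] (1.18) p. 20: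
# **THE COMPOSITE SITE AVERAGING `Q′_k(U) = Q′(Ū^{k−1})⋯Q′(U)` AGAINST THE BIG BLOCK MEAN `Q′_k(1)`, AT ONE UNIT BLOCK, FROM THE LEVEL BONDS OVER
# THAT BLOCK ONLY** — `‖(Q′_k(R)l)(y) − (Q′_k(1)l)(y)‖ ≤ (Π_{j<k}(1 + ε_j)^{d(L−1)} − 1)·L^{−kd}·Σ_{x over y} ‖l(x)‖`: the `k`-level twin of
# `B9Eq319QprimeBlockLocal.norm_QprimeLin_sub_flat_apply_le_local` (this lineage's (P0)), the block-local letter of the tower Tier P programme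

statement-level skeleton of published theorems with citation tags; proofs where landed; nothing here is a claim about the Yang–Mills mass gap

CITATION HEADER (lean-in-tree rule).  Audit cell `pub-balaban`, sub-cell `t4`, BINDER row NE9; filed by NE9 formalisation-swarm leaf prover 03
(`b2b-balaban-t4-ne9-formalise-leaf-03`, gen 64), brick (T3) of the k-level Tier P programme (journal l.47756).  Source READ in the held text:
[Balaban1985BackgroundPropagators] pp. 393, 395–396, 403, 416 (`paper:balaban1985-cmp99-background-propagators`, journal page = PDF page + 388);
[Balaban1984PropagatorsI] p. 20.  Objects BY NAME: `B9Eq315QTower.QprimeTower` (the owner's composite (3.19)), `B9Eq319QprimeTorus.QprimeLin` ∕ `blockCoord`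
∕ `blockOf`, the owner's `B9Eq316TowerFlatIsOneStep.QprimeTower_flat_apply` ∕ `div_pow_succ_iff` ∕ `filter_blockCoord_eq_blockOf`, this lineage's
`B9Eq319QprimeBlockLocal.norm_QprimeLin_sub_flat_apply_le_local`; nothing re-declared, 0 `def`.

THE PRINT (verbatim).  p. 393 (3.19): *«Q′_j(U) = Q′(Ū^{j−1}) … Q′(U)»*; (3.15): *«Ū^{j+1} = \overline{Ū^j}»*; p. 403: *«the averaging operations
depend analytically on U»*; [Balaban1984PropagatorsI] (1.18) p. 20: *«a composition of k transformations … is again a transformation of the same type with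
L replaced by L^k»*; p. 396 (3.35): *«there exists a gauge transformation u on □ such that U^u = e^{iηA} …»* — a LOCAL (cube-wise) hypothesis.

WHAT IS PROVED (sorry-free; proof lane — 0 `def`; [folklore] induction on the owner's recursion `QprimeTower_succ`).
* §1 `norm_QprimeTower_flat_apply_le` — the flat composite is an `ℓ¹`-mean contraction pointwise: `‖(Q′_n(1)h)(y)‖ ≤ L^{−nd}·Σ_{z over y}‖h z‖`
  (`QprimeTower_flat_apply`); `sum_over_succ_eq` — `Σ_{z over_n y} Σ_{x ∈ B(z)} F x = Σ_{x over_{n+1} y} F x` (the owner's fibrewise lemmas).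
* §2 **`norm_QprimeTower_sub_flat_apply_le_local`** — for level transporter data `R_j` on the bonds of `T_{L^{j+1}m}` and a profile `ε_j ≥ 0`: IF
  for every `j < n` every bond `(x, μ)` of level `j+1` that is INTERNAL to a level-`j` block (`blockCoord x = blockCoord (x + e_μ)`) and LIES OVER the
  unit-lattice site `y` (`x_i div L^{j+1} = y_i`) has `‖R_j(x, μ)v − v‖ ≤ ε_j‖v‖`, THEN for every `l`,
  `‖(Q′_n(R)l)(y) − (Q′_n(1)l)(y)‖ ≤ (Π_{j<n}(1 + ε_j)^{d(L−1)} − 1)·((L^n)^d)⁻¹·Σ_{x : x_i div L^n = y_i}‖l x‖` — NO hypothesis on any bond not over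
  `y`; the induction `E_{n+1} ≤ (Π_{<n} − 1)(1 + ρ_n)M + ρ_nM`, `ρ_j = (1+ε_j)^{d(L−1)} − 1`, splits `Q′_{n+1}(R) − Q′_{n+1}(1) = [Q′_n(R) − Q′_n(1)]∘Q′(R_n)
  + Q′_n(1)∘[Q′(R_n) − Q′(1)]` and feeds (P0) at the finest factor.
WHY (cell context).  ne9-leaf-02's `B9Eq319QprimeTowerLipschitzL2` is the GLOBAL `ℓ²` telescoping of the same difference (every level bond of the torus
displayed); the per-block gauge argument of the tower Tier P (the `k`-twin of `B9Thm311SitePrimeFormCoerciveBlockGauge`, next file) gauges ONE unit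
block at a time, so it needs the letter with hypotheses on the bonds OVER THAT BLOCK only — this file; the `W`-reading for `B9Eq326OperatorTower.QprimeTowerW`
(`= Q′_{n+1}(R(Ū^j)) ∘ WL2.equiv`) is §3 `norm_QprimeTowerW_sub_flat_apply_le_local` (hypotheses: the transporters `R(Ū^j(b))` of the level bonds over
the block; the flat side through `UlevOf_one` ∕ `adTransportW_one`).
HONEST SCOPE.  [folklore] lattice bookkeeping on the owner's recursion and this lineage's one-step local letter; nothing of [B9] asserted; the profile
`ε_j` is DISPLAYED (its discharge from the plaquette class is `B7Eq47AveragedBondVsStraight` + the block axial gauge, other files).  NOT summit progress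
(cell pub-balaban: NE9 NOT PRINTED ∕ NOT PROVED; «NE9 ⇐ the named binders»; spine PROVED 0/9; rung (B)+1 finite T⁴ — NOT infinite volume, NOT mass gap,
NOT Clay; HONEST DEPENDENCY: continuum YM on T⁴ ⇐ BetaPertH ∧ nine spine estimates (0/9 proved); BetaPertH ⇐ (D1) ∧ (D4) ∧ CAP+tail; G-an2-4 gates
asym, D1 and NE2/3/4).  NEW file; nothing modified.  Net new unproved facts: 0.
-/

noncomputable section

open scoped BigOperators

namespace Literature.MathematicalPhysics.QuantumFieldTheory.Balaban1983to89.B9Eq319QprimeTowerBlockLocal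

open B4Sect5Torus (TSite)
open B9SectCLatticeCarrier (Bond shift)
open B9Eq319QprimeTorus (fineP blockCoord QprimeLin mem_blockOf_iff)
open B9Eq315QTower (towerP QprimeTower QprimeTower_zero QprimeTower_succ)
open B9Eq316TowerFlatIsOneStep (QprimeTower_flat_apply div_pow_succ_iff filter_blockCoord_eq_blockOf)
open B9Eq319QprimeLipschitz (QprimeLin_flat_apply)
open B9Eq319QprimeBlockLocal (norm_QprimeLin_sub_flat_apply_le_local)
open B9Eq311L2Pairing (WL2)
open B11Eq103H1Complex (SiteL2K)
open B9Eq310HessianOperator (adTransportW)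
open B9Eq315QTower (UlevOf)
open B9Eq315QTowerFlat (UlevOf_one)
open B9Eq326OperatorTower (QprimeTowerW)
open B5Eq172HodgePositivity (adTransportW_one)

variable {d : ℕ} (L : ℕ) [NeZero L] (m : Fin d → ℕ) {V : Type*} [NormedAddCommGroup V] [NormedSpace ℂ V]

/-! ## §1 The flat composite is a pointwise `ℓ¹`-mean contraction; the fibrewise sum -/

/-- **`‖(Q′_n(1)h)(y)‖ ≤ ((L^n)^d)⁻¹·Σ_{z over y}‖h z‖`** — the flat composite is the big block mean (the owner's `QprimeTower_flat_apply`).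
[cite: Balaban1984PropagatorsI, (1.18) p.20; Balaban1985BackgroundPropagators, (3.19) p.393] -/
theorem norm_QprimeTower_flat_apply_le (n : ℕ) (h : TSite d (towerP L m n) → V) (y : TSite d m) :
    ‖QprimeTower L m (fun _ _ => (LinearMap.id : V →ₗ[ℂ] V)) n h y‖ ≤
      (((L : ℝ) ^ n) ^ d)⁻¹ * ∑ z ∈ Finset.univ.filter (fun z : TSite d (towerP L m n) => ∀ i, (z i : ℕ) / L ^ n = (y i : ℕ)), ‖h z‖ := by
  rw [QprimeTower_flat_apply, Finset.mul_sum]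
  refine (norm_sum_le _ _).trans (Finset.sum_le_sum fun z _ => ?_)
  rw [norm_smul, norm_inv, norm_pow, norm_pow, Real.norm_natCast]

omit [NeZero L] in
/-- **THE FIBREWISE SUM: `Σ_{z over_n y} Σ_{x ∈ B(z)} F x = Σ_{x over_{n+1} y} F x`** (the owner's `div_pow_succ_iff` ∕ `filter_blockCoord_eq_blockOf`).
[cite: Balaban1985Averaging, (2)–(4) pp.17–18; Balaban1985BackgroundPropagators, (3.19) p.393] -/
theorem sum_over_succ_eq (n : ℕ) (y : TSite d m) (F : TSite d (fineP L (towerP L m n)) → ℝ) :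
    ∑ z ∈ Finset.univ.filter (fun z : TSite d (towerP L m n) => ∀ i, (z i : ℕ) / L ^ n = (y i : ℕ)),
        ∑ x ∈ B9Eq319QprimeTorus.blockOf L (towerP L m n) z, F x =
      ∑ x ∈ Finset.univ.filter (fun x : TSite d (fineP L (towerP L m n)) => ∀ i, (x i : ℕ) / L ^ (n + 1) = (y i : ℕ)), F x := by
  rw [← Finset.sum_fiberwise_of_maps_to (g := blockCoord L (towerP L m n))
    (t := Finset.univ.filter (fun z : TSite d (towerP L m n) => ∀ i, (z i : ℕ) / L ^ n = (y i : ℕ)))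
    (s := Finset.univ.filter (fun x : TSite d (fineP L (towerP L m n)) => ∀ i, (x i : ℕ) / L ^ (n + 1) = (y i : ℕ))) (f := F) ?_]
  · refine Finset.sum_congr rfl fun z hz => ?_
    rw [Finset.mem_filter] at hz
    rw [filter_blockCoord_eq_blockOf L m n y hz.2]
  · intro x hx
    rw [Finset.mem_filter] at hx ⊢
    exact ⟨Finset.mem_univ _, (div_pow_succ_iff L m n x y).1 hx.2⟩

/-! ## §2 The composite against the big block mean, hypotheses on the bonds over the block only -/

/-- **THE COMPOSITE `Q′_n(R)` AGAINST `Q′_n(1)` AT ONE UNIT BLOCK, FROM THE LEVEL BONDS OVER THAT BLOCK ONLY**: with `ρ_j = (1 + ε_j)^{d(L−1)} − 1`,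
`‖(Q′_n(R)l)(y) − (Q′_n(1)l)(y)‖ ≤ (Π_{j<n}(1 + ε_j)^{d(L−1)} − 1)·((L^n)^d)⁻¹·Σ_{x over y}‖l x‖` whenever, for every `j < n`, the level-`(j+1)`
bonds internal to a level-`j` block and lying over `y` carry transporters `ε_j`-close to the identity — induction on `QprimeTower_succ`:
`Q′_{n+1}(R) − Q′_{n+1}(1) = [Q′_n(R) − Q′_n(1)]∘Q′(R_n) + Q′_n(1)∘[Q′(R_n) − Q′(1)]`, the first by the induction hypothesis on `g = Q′(R_n)l` with
`‖g z‖ ≤ (1 + ρ_n)·L^{−d}Σ_{B(z)}‖l‖` ((P0) + the flat mean), the second by §1 and (P0); `(Π_{<n} − 1)(1 + ρ_n) + ρ_n = Π_{<n+1} − 1`.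
[cite: Balaban1985BackgroundPropagators, (3.19) p.393, p.403, (3.35) p.396, Thm 3.11 p.416; Balaban1984PropagatorsI, (1.18) p.20] -/
theorem norm_QprimeTower_sub_flat_apply_le_local (Rlev : (j : ℕ) → Bond d (towerP L m (j + 1)) → V →ₗ[ℂ] V) (ε : ℕ → ℝ) (hε : ∀ j, 0 ≤ ε j)
    (y : TSite d m) :
    ∀ n : ℕ, (∀ j < n, ∀ (x : TSite d (towerP L m (j + 1))) (μ : Fin d),
        blockCoord L (towerP L m j) x = blockCoord L (towerP L m j) (shift μ x) → (∀ i, (x i : ℕ) / L ^ (j + 1) = (y i : ℕ)) →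
          ∀ v, ‖Rlev j (x, μ) v - v‖ ≤ ε j * ‖v‖) →
      ∀ l : TSite d (towerP L m n) → V,
        ‖QprimeTower L m Rlev n l y - QprimeTower L m (fun _ _ => (LinearMap.id : V →ₗ[ℂ] V)) n l y‖ ≤
          ((∏ j ∈ Finset.range n, (1 + ε j) ^ (d * (L - 1))) - 1) *
            ((((L : ℝ) ^ n) ^ d)⁻¹ * ∑ x ∈ Finset.univ.filter (fun x : TSite d (towerP L m n) => ∀ i, (x i : ℕ) / L ^ n = (y i : ℕ)), ‖l x‖)
  | 0, _, l => by simp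
  | n + 1, hR, l => by
    -- names
    set Rn : Bond d (fineP L (towerP L m n)) → V →ₗ[ℂ] V := Rlev n with hRn
    set g : TSite d (towerP L m n) → V := QprimeLin L (towerP L m n) Rn l with hg
    set g₁ : TSite d (towerP L m n) → V := QprimeLin L (towerP L m n) (fun _ => (LinearMap.id : V →ₗ[ℂ] V)) l with hg₁
    set Pr : ℝ := ∏ j ∈ Finset.range n, (1 + ε j) ^ (d * (L - 1)) with hPr
    set ρ : ℝ := (1 + ε n) ^ (d * (L - 1)) - 1 with hρ
    set S : Finset (TSite d (towerP L m n)) := Finset.univ.filter (fun z : TSite d (towerP L m n) => ∀ i, (z i : ℕ) / L ^ n = (y i : ℕ)) with hS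
    set S' : Finset (TSite d (towerP L m (n + 1))) :=
      Finset.univ.filter (fun x : TSite d (towerP L m (n + 1)) => ∀ i, (x i : ℕ) / L ^ (n + 1) = (y i : ℕ)) with hS'
    have hLd : (0 : ℝ) < (L : ℝ) ^ d := pow_pos (by exact_mod_cast Nat.pos_of_ne_zero (NeZero.ne L)) d
    have hw : 0 ≤ (((L : ℝ) ^ n) ^ d)⁻¹ := by positivity
    have hw1 : 0 ≤ ((L : ℝ) ^ d)⁻¹ := by positivity
    have hρ0 : 0 ≤ ρ := by
      rw [hρ]; exact sub_nonneg.2 (one_le_pow₀ (by linarith [hε n]))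
    have hPr1 : 1 ≤ Pr := by
      rw [hPr]; exact Finset.one_le_prod (s := Finset.range n) fun j _ => one_le_pow₀ (by linarith [hε j])
    -- the two factors
    have e1 : QprimeTower L m Rlev (n + 1) l = QprimeTower L m Rlev n g := by rw [QprimeTower_succ]; rfl
    have e2 : QprimeTower L m (fun _ _ => (LinearMap.id : V →ₗ[ℂ] V)) (n + 1) l = QprimeTower L m (fun _ _ => (LinearMap.id : V →ₗ[ℂ] V)) n g₁ := by
      rw [QprimeTower_succ]; rfl
    -- (P0) at the finest factor, at every level-`n` site `z` over `y`
    have hP0 : ∀ z ∈ S, ‖g z - g₁ z‖ ≤ ρ * (((L : ℝ) ^ d)⁻¹ * ∑ x ∈ B9Eq319QprimeTorus.blockOf L (towerP L m n) z, ‖l x‖) := by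
      intro z hz
      rw [hS, Finset.mem_filter] at hz
      refine norm_QprimeLin_sub_flat_apply_le_local L (towerP L m n) Rn (hε n) z ?_ l
      intro x μ hx hxμ v
      refine hR n (Nat.lt_succ_self n) x μ (by rw [hx, hxμ]) ?_ v
      exact (div_pow_succ_iff L m n x y).2 (by rw [hx]; exact hz.2)
    -- the flat factor at `z`: `‖g₁ z‖ ≤ L^{−d} Σ_{B(z)} ‖l‖`
    have hflat : ∀ z : TSite d (towerP L m n), ‖g₁ z‖ ≤ ((L : ℝ) ^ d)⁻¹ * ∑ x ∈ B9Eq319QprimeTorus.blockOf L (towerP L m n) z, ‖l x‖ := by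
      intro z
      rw [hg₁, QprimeLin_flat_apply, Finset.mul_sum]
      refine (norm_sum_le _ _).trans (Finset.sum_le_sum fun x _ => ?_)
      rw [norm_smul, norm_inv, norm_pow, Real.norm_natCast]
    -- the induction hypothesis on `g`
    have ih := norm_QprimeTower_sub_flat_apply_le_local Rlev ε hε y n (fun j hj => hR j (Nat.lt_succ_of_lt hj)) g
    -- the fibrewise sum
    have hfib : ∑ z ∈ S, ∑ x ∈ B9Eq319QprimeTorus.blockOf L (towerP L m n) z, ‖l x‖ = ∑ x ∈ S', ‖l x‖ :=
      sum_over_succ_eq L m n y (fun x => ‖l x‖)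
    -- `Σ_{z ∈ S} ‖g z‖ ≤ (1 + ρ) L^{−d} Σ_{S'} ‖l‖`
    have hsumg : ∑ z ∈ S, ‖g z‖ ≤ (1 + ρ) * (((L : ℝ) ^ d)⁻¹ * ∑ x ∈ S', ‖l x‖) := by
      calc ∑ z ∈ S, ‖g z‖ ≤ ∑ z ∈ S, (1 + ρ) * (((L : ℝ) ^ d)⁻¹ * ∑ x ∈ B9Eq319QprimeTorus.blockOf L (towerP L m n) z, ‖l x‖) :=
            Finset.sum_le_sum fun z hz => by
              have h1 := hP0 z hz
              have h2 := hflat z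
              have h3 : ‖g z‖ ≤ ‖g₁ z‖ + ‖g z - g₁ z‖ := by
                have := norm_add_le (g₁ z) (g z - g₁ z); rwa [add_sub_cancel] at this
              nlinarith
        _ = (1 + ρ) * (((L : ℝ) ^ d)⁻¹ * ∑ x ∈ S', ‖l x‖) := by rw [← Finset.mul_sum, ← Finset.mul_sum, hfib]
    -- `Σ_{z ∈ S} ‖g z − g₁ z‖ ≤ ρ L^{−d} Σ_{S'} ‖l‖`
    have hsumd : ∑ z ∈ S, ‖g z - g₁ z‖ ≤ ρ * (((L : ℝ) ^ d)⁻¹ * ∑ x ∈ S', ‖l x‖) := by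
      calc ∑ z ∈ S, ‖g z - g₁ z‖ ≤ ∑ z ∈ S, ρ * (((L : ℝ) ^ d)⁻¹ * ∑ x ∈ B9Eq319QprimeTorus.blockOf L (towerP L m n) z, ‖l x‖) :=
            Finset.sum_le_sum hP0
        _ = ρ * (((L : ℝ) ^ d)⁻¹ * ∑ x ∈ S', ‖l x‖) := by rw [← Finset.mul_sum, ← Finset.mul_sum, hfib]
    -- the first term
    have hA : ‖QprimeTower L m Rlev n g y - QprimeTower L m (fun _ _ => (LinearMap.id : V →ₗ[ℂ] V)) n g y‖ ≤
        (Pr - 1) * ((((L : ℝ) ^ n) ^ d)⁻¹ * ((1 + ρ) * (((L : ℝ) ^ d)⁻¹ * ∑ x ∈ S', ‖l x‖))) :=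
      ih.trans (mul_le_mul_of_nonneg_left (mul_le_mul_of_nonneg_left hsumg hw) (by linarith))
    -- the second term: `Q′_n(1)(g − g₁)`
    have hB : ‖QprimeTower L m (fun _ _ => (LinearMap.id : V →ₗ[ℂ] V)) n g y - QprimeTower L m (fun _ _ => (LinearMap.id : V →ₗ[ℂ] V)) n g₁ y‖ ≤
        (((L : ℝ) ^ n) ^ d)⁻¹ * (ρ * (((L : ℝ) ^ d)⁻¹ * ∑ x ∈ S', ‖l x‖)) := by
      rw [← Pi.sub_apply, ← map_sub]
      refine (norm_QprimeTower_flat_apply_le L m n (g - g₁) y).trans ?_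
      rw [← hS]
      exact mul_le_mul_of_nonneg_left (by simpa only [Pi.sub_apply] using hsumd) hw
    -- assemble
    rw [e1, e2]
    have hpow : (((L : ℝ) ^ (n + 1)) ^ d)⁻¹ = (((L : ℝ) ^ n) ^ d)⁻¹ * ((L : ℝ) ^ d)⁻¹ := by
      rw [pow_succ, mul_pow, mul_inv]
    have hprod : (∏ j ∈ Finset.range (n + 1), (1 + ε j) ^ (d * (L - 1))) - 1 = Pr * (1 + ρ) - 1 := by
      rw [Finset.prod_range_succ, hPr, hρ]; ring
    rw [hprod, hpow]
    set M : ℝ := (((L : ℝ) ^ n) ^ d)⁻¹ * (((L : ℝ) ^ d)⁻¹ * ∑ x ∈ S', ‖l x‖) with hM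
    have hM0 : 0 ≤ M := by rw [hM]; positivity
    calc ‖QprimeTower L m Rlev n g y - QprimeTower L m (fun _ _ => (LinearMap.id : V →ₗ[ℂ] V)) n g₁ y‖
        ≤ ‖QprimeTower L m Rlev n g y - QprimeTower L m (fun _ _ => (LinearMap.id : V →ₗ[ℂ] V)) n g y‖ +
            ‖QprimeTower L m (fun _ _ => (LinearMap.id : V →ₗ[ℂ] V)) n g y - QprimeTower L m (fun _ _ => (LinearMap.id : V →ₗ[ℂ] V)) n g₁ y‖ :=
          norm_sub_le_norm_sub_add_norm_sub _ _ _
      _ ≤ (Pr - 1) * ((1 + ρ) * M) + ρ * M := by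
          refine add_le_add (hA.trans (le_of_eq ?_)) (hB.trans (le_of_eq ?_)) <;> rw [hM] <;> ring
      _ = (Pr * (1 + ρ) - 1) * M := by ring
      _ = (Pr * (1 + ρ) - 1) * ((((L : ℝ) ^ n) ^ d)⁻¹ * ((L : ℝ) ^ d)⁻¹ * ∑ x ∈ S', ‖l x‖) := by rw [hM, mul_assoc]


/-! ## §3 The reading on the NE9 chain's `QprimeTowerW` -/

section W

variable [∀ i, NeZero (m i)] {𝔸 : Type*} [NormedRing 𝔸] [NormedAlgebra ℂ 𝔸] [CompleteSpace 𝔸]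
  {W : Type*} [NormedAddCommGroup W] [InnerProductSpace ℂ W] (φ : W ≃ₗ[ℂ] 𝔸) {c₀ : ℝ} (n : ℕ)
  (U : Bond d (towerP L m (n + 1)) → 𝔸ˣ)

/-- **THE COMPOSITE `Q′_{n+1}(U)` OF THE CHAIN AGAINST ITS FLAT VALUE AT ONE UNIT BLOCK, FROM THE LEVEL BONDS OVER THAT BLOCK ONLY**: if for every
level `j ≤ n` the transporters `R(Ū^j(b))` of the level-`(j+1)` bonds `b = (x, μ)` internal to a level-`j` block and lying over `y` are `ε_j`-close to the
identity on the fibre, then `‖(Q′_{n+1}(U)λ)(y) − (Q′_{n+1}(1)λ)(y)‖ ≤ (Π_{j≤n}(1 + ε_j)^{d(L−1)} − 1)·((L^{n+1})^d)⁻¹·Σ_{x over y}‖λ(x)‖` — §2 at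
`R_j := R(Ū^j)`, the flat side by `UlevOf_one` ∕ `adTransportW_one`; the letter the per-block gauge argument consumes with `U` := the block's gauged field.
[cite: Balaban1985BackgroundPropagators, (3.19) p.393, (3.24) p.394, (3.35) p.396, Thm 3.11 p.416] -/
theorem norm_QprimeTowerW_sub_flat_apply_le_local (ε : ℕ → ℝ) (hε : ∀ j, 0 ≤ ε j) (y : TSite d m)
    (hR : ∀ j < n + 1, ∀ (x : TSite d (towerP L m (j + 1))) (μ : Fin d),
        blockCoord L (towerP L m j) x = blockCoord L (towerP L m j) (shift μ x) → (∀ i, (x i : ℕ) / L ^ (j + 1) = (y i : ℕ)) →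
          ∀ w, ‖adTransportW φ (UlevOf L m (n + 1) U j) (x, μ) w - w‖ ≤ ε j * ‖w‖)
    (lam : SiteL2K ℂ d (towerP L m (n + 1)) c₀ W) :
    ‖QprimeTowerW L m n φ U (c₀ := c₀) lam y - QprimeTowerW L m n φ (fun _ : Bond d (towerP L m (n + 1)) => (1 : 𝔸ˣ)) (c₀ := c₀) lam y‖ ≤
      ((∏ j ∈ Finset.range (n + 1), (1 + ε j) ^ (d * (L - 1))) - 1) *
        ((((L : ℝ) ^ (n + 1)) ^ d)⁻¹ * ∑ x ∈ Finset.univ.filter (fun x : TSite d (towerP L m (n + 1)) => ∀ i, (x i : ℕ) / L ^ (n + 1) = (y i : ℕ)),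
          ‖WL2.equiv ℂ (fun _ : TSite d (towerP L m (n + 1)) => c₀) W lam x‖) := by
  have hflat : (fun j => adTransportW φ (UlevOf L m (n + 1) (fun _ : Bond d (towerP L m (n + 1)) => (1 : 𝔸ˣ)) j)) =
      fun _ _ => (LinearMap.id : W →ₗ[ℂ] W) := by
    funext j b; rw [UlevOf_one, adTransportW_one]
  have hU : QprimeTowerW L m n φ U (c₀ := c₀) lam y =
      QprimeTower L m (fun j => adTransportW φ (UlevOf L m (n + 1) U j)) (n + 1) (WL2.equiv ℂ (fun _ : TSite d (towerP L m (n + 1)) => c₀) W lam) y :=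
    rfl
  have h1 : QprimeTowerW L m n φ (fun _ : Bond d (towerP L m (n + 1)) => (1 : 𝔸ˣ)) (c₀ := c₀) lam y =
      QprimeTower L m (fun _ _ => (LinearMap.id : W →ₗ[ℂ] W)) (n + 1) (WL2.equiv ℂ (fun _ : TSite d (towerP L m (n + 1)) => c₀) W lam) y := by
    rw [QprimeTowerW, hflat]; rfl
  rw [hU, h1]
  exact norm_QprimeTower_sub_flat_apply_le_local L m (fun j => adTransportW φ (UlevOf L m (n + 1) U j)) ε hε y (n + 1) hR _

end W

end Literature.MathematicalPhysics.QuantumFieldTheory.Balaban1983to89.B9Eq319QprimeTowerBlockLocal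

end
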